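import Literature.AlgebraicGeometry.Resolution.QuasiExcellentSchemes
import Literature.AlgebraicGeometry.Resolution.ExcellentRingsFieldProofs
import Mathlib.AlgebraicGeometry.Morphisms.Etale
import Mathlib.RingTheory.GradedAlgebra.Basic
import HarnessLib

/-!
# Crux `FrobeniusLadder.FRationalResolution` (stmt-ResolutionOfSingularities-15317), line `redirect`,
# stub `stub_diagonalizableQuotientResolution` — the whole `dim X ≤ 3` part of the stub is the print the
# route already pays for in crux 15315 (allocation bookkeeping of leafhand-4 g4's census)

The registered skeleton `step_door` v41.1 of crux stmt-ResolutionOfSingularities-15315 consumes the named fact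
`Literature.AlgebraicGeometry.Resolution.CossartPiltant2019General` (Cossart–Piltant 2019, Thm. 1.1 as printed:
reduced separated Noetherian quasi-excellent schemes of dimension `≤ 3` have a resolution) as the first conjunct
of its `stub_namedFacts`. This file records, in kernel-checked form, that the SAME named fact — with no further
input — settles `stub_diagonalizableQuotientResolution` of crux 15317 for every `X` of dimension `≤ 3`, over EVERY
field (perfect or not, any characteristic), with the stub's binders verbatim and its chart hypothesis `hq` unused:

* `stub_diagonalizableQuotientResolution_of_cossartPiltant2019_of_dim_le_three` — from the field form
  `CossartPiltant2019` (all fields, all characteristics);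
* `stub_diagonalizableQuotientResolution_of_cossartPiltant2019General_of_dim_le_three` — from the printed
  form `CossartPiltant2019General` through the PROVED excellence of finite type algebras over a field
  (`Stacks07QW_field_holds`) and `CossartPiltant2019General.cossartPiltant2019`.

Consequence for staffing (memo MEMO-leafhand4-g4, §4.1): every dimension-`3` slice of the stub (in particular
the «twisted isolated threefold points over a non-separably-closed field» residue of leafhand-4's lane W) is
print-covered at route level at zero extra cost; print-free work below dimension `4` buys print-freeness only.
Both theorems are CONDITIONAL on an unproved named fact (the gate records `proof.conditional`); no stub is
closed by name. No definitions, no new named facts, no sorry. [cite: CossartPiltant2019, Thm. 1.1]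
-/

noncomputable section

-- single-problem summit: the doubled namespace component is forced
set_option linter.dupNamespace false

open CategoryTheory AlgebraicGeometry
open Literature.AlgebraicGeometry.Resolution

namespace Summit.ResolutionOfSingularities.ResolutionOfSingularities.Theorems.FRationalResolution.DiagQuotientDimLeThreeOfPrint

/-- **`stub_diagonalizableQuotientResolution` in dimension `≤ 3`, modulo Cossart–Piltant 2019 (field form).**
Binders of the registered stub verbatim (any field `k`, any characteristic) plus `topologicalKrullDim X ≤ 3`;
the chart hypothesis is not used: an integral scheme is reduced, and `CossartPiltant2019` resolves every reduced
separated finite-type scheme of dimension `≤ 3` over a field. [cite: CossartPiltant2019, Thm. 1.1] -/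
theorem stub_diagonalizableQuotientResolution_of_cossartPiltant2019_of_dim_le_three
    (hCP : CossartPiltant2019.{0}) (k : Type) [Field k] (X : Scheme.{0}) (g : X ⟶ Spec (.of k))
    [IsIntegral X] [IsSeparated g] [LocallyOfFiniteType g] [QuasiCompact g]
    (_hq : ∀ x : X, ∃ (A : Type) (_ : AddCommGroup A) (_ : Finite A) (_ : DecidableEq A)
        (S : Type) (_ : CommRing S) (_ : Algebra k S) (𝒮 : A → Submodule k S)
        (_ : GradedAlgebra 𝒮), Algebra.FiniteType k S ∧ IsRegularRing S ∧
        ∃ φ : Spec (.of (𝒮 0)) ⟶ X, Etale φ ∧ x ∈ Set.range φ ∧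
          φ ≫ g = Spec.map (CommRingCat.ofHom (algebraMap k (𝒮 0))))
    (hdim : topologicalKrullDim X ≤ 3) :
    Scheme.HasResolution X :=
  hCP k X g inferInstance inferInstance inferInstance inferInstance hdim

/-- **`stub_diagonalizableQuotientResolution` in dimension `≤ 3`, modulo EXACTLY the first conjunct of crux 15315's
`stub_namedFacts`** (`CossartPiltant2019General`, CP 2019 Thm. 1.1 as printed for quasi-excellent schemes):
finite type algebras over a field are excellent (`Stacks07QW_field_holds`, proved in the tree), so the printed form
gives the field form (`CossartPiltant2019General.cossartPiltant2019`) and the previous theorem applies.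
[cite: CossartPiltant2019, Thm. 1.1] [cite: StacksProject, Tag 07QW] -/
theorem stub_diagonalizableQuotientResolution_of_cossartPiltant2019General_of_dim_le_three
    (hCP : CossartPiltant2019General.{0}) (k : Type) [Field k] (X : Scheme.{0}) (g : X ⟶ Spec (.of k))
    [IsIntegral X] [IsSeparated g] [LocallyOfFiniteType g] [QuasiCompact g]
    (hq : ∀ x : X, ∃ (A : Type) (_ : AddCommGroup A) (_ : Finite A) (_ : DecidableEq A)
        (S : Type) (_ : CommRing S) (_ : Algebra k S) (𝒮 : A → Submodule k S)
        (_ : GradedAlgebra 𝒮), Algebra.FiniteType k S ∧ IsRegularRing S ∧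
        ∃ φ : Spec (.of (𝒮 0)) ⟶ X, Etale φ ∧ x ∈ Set.range φ ∧
          φ ≫ g = Spec.map (CommRingCat.ofHom (algebraMap k (𝒮 0))))
    (hdim : topologicalKrullDim X ≤ 3) :
    Scheme.HasResolution X :=
  stub_diagonalizableQuotientResolution_of_cossartPiltant2019_of_dim_le_three
    (hCP.cossartPiltant2019 Stacks07QW_field_holds) k X g hq hdim

end Summit.ResolutionOfSingularities.ResolutionOfSingularities.Theorems.FRationalResolution.DiagQuotientDimLeThreeOfPrint

end
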